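import Summits.Ventures.PackingBounds.Configurations.KissingConstructionA
import Summits.Ventures.PackingBounds.Kissing.DimensionFifteen

/-!
# The local arrangement `P₁₅ₐ`: `κ(15) ≥ 2564` in Lean

Framing: lottery ticket; floor = certified bounds/negative ranges. Venture `PackingBounds` (cell
`pub-packcert`, seat `pub-packcert-energy`).

Leech–Sloane's five-layer local arrangement `P₁₅ₐ` (Conway–Sloane, *SPLAG* Ch. 5 §4.3): the central layer is the
Construction A arrangement `P₁₄ₐ` on the `91` tetrads of the Steiner system `S(3,4,14)` (`28 + 16 · 91 = 1484`
vectors), the two adjacent layers are `(c, 0) − ((½)¹⁴, ±½√2)` with `c` in the `[14,9,4]` shortened Hamming code,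
resp. in its coset by `(1,1,0¹²)` (`2 · 512`), and the two outer layers consist of the `2 · 28` vectors `(x, ±√2)` with
`x` supported on one pair `{2i, 2i+1}` with entries `±1`. The central sphere touches **`1484 + 1024 + 56 = 2564`**
others — the record lower bound for the kissing number in dimension `15` (SPLAG Table 1.2). Integer model at scale
`2` in `ℤ²⁴` (cells `0..13`, the `√2`-axis doubled on `16, 17`; norm `16`, kissing condition `ip ≤ 8`) with the
pattern vectors of `CL17Vectors.lean`; `S(3,4,14)` is entered from SPLAG's base tetrads, the code as the span of `9`
generators; the kernel checks the tetrad intersections, the minimum distance `4` and the coset weight `≥ 2`.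

## References
* J. H. Conway, N. J. A. Sloane, *Sphere Packings, Lattices and Groups*, Ch. 5 §4.3 and Table 1.2. [`ConwaySloane1999`]
-/

namespace Summit.Ventures.PackingBounds.Config.ConsA

open Finset Leech Golay CL17

attribute [local irreducible] consA blockVecs pointVecs

/-! ### Data: `S(3,4,14)` and the `[14,9,4]` code -/

/-- The `91` tetrads of `S(3,4,14)` (SPLAG's thirteen base tetrads on `1…7, 1'…7'` and their cyclic shifts), as
`14`-bit masks. [cite: ConwaySloane1999, Ch. 5 §4.3] -/
def blk14 (b : ℕ) : ℕ :=
  match b with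
  | 0 => 39 | 1 => 267 | 2 => 83 | 3 => 8323 | 4 => 1539 | 5 => 6147 | 6 => 29 | 7 => 197 | 8 => 8453 | 9 => 2565
  | 10 => 5125 | 11 => 105 | 12 => 2185 | 13 => 4617 | 14 => 9225 | 15 => 4145 | 16 => 1169 | 17 => 2321 | 18 => 8721
  | 19 => 673 | 20 => 1313 | 21 => 10273 | 22 => 833 | 23 => 3137 | 24 => 12353 | 25 => 4481 | 26 => 78 | 27 => 534
  | 28 => 390 | 29 => 3078 | 30 => 12294 | 31 => 58 | 32 => 650 | 33 => 5130 | 34 => 10250 | 35 => 2194 | 36 => 4370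
  | 37 => 9234 | 38 => 8290 | 39 => 1186 | 40 => 2338 | 41 => 4642 | 42 => 4290 | 43 => 1346 | 44 => 2626 | 45 => 8962
  | 46 => 1068 | 47 => 8332 | 48 => 780 | 49 => 6156 | 50 => 116 | 51 => 4244 | 52 => 1300 | 53 => 10260 | 54 => 2212
  | 55 => 4388 | 56 => 8740 | 57 => 2372 | 58 => 4676 | 59 => 9284 | 60 => 1668 | 61 => 2136 | 62 => 408 | 63 => 1560
  | 64 => 12312 | 65 => 4264 | 66 => 8488 | 67 => 2600 | 68 => 1224 | 69 => 4424 | 70 => 8776 | 71 => 3336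
  | 72 => 8368 | 73 => 816 | 74 => 3120 | 75 => 720 | 76 => 8528 | 77 => 5200 | 78 => 6672 | 79 => 480 | 80 => 1632
  | 81 => 6240 | 82 => 13344 | 83 => 10432 | 84 => 2944 | 85 => 9600 | 86 => 12928 | 87 => 7296 | 88 => 5888
  | 89 => 14592 | 90 => 11776
  | _ => 0

/-- Generators of a `[14,9,4]` code (the `[16,11,4]` extended Hamming code `RM(2,4)` shortened twice). -/
def ham14gen (b : ℕ) : ℕ :=
  match b with
  | 0 => 15 | 1 => 51 | 2 => 85 | 3 => 150 | 4 => 771 | 5 => 1285 | 6 => 2310 | 7 => 4369 | 8 => 8466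
  | _ => 0

/-- `XOR` of the generators selected by the bits of `m`, using the first `j` generators. -/
def hamAux : ℕ → ℕ → ℕ
  | 0, _ => 0
  | j + 1, m => (if m.testBit j then ham14gen j else 0) ^^^ hamAux j m

/-- The codeword with coordinates `m < 512`. -/
def ham14 (m : ℕ) : ℕ := hamAux 9 m

/-- `hamAux` is additive. -/
theorem hamAux_xor (j m m' : ℕ) : hamAux j (m ^^^ m') = hamAux j m ^^^ hamAux j m' := by
  induction j with
  | zero => simp [hamAux]
  | succ j ih =>
    simp only [hamAux, Nat.testBit_xor, ih]
    cases m.testBit j <;> cases m'.testBit j <;> simp [Nat.xor_assoc, Nat.xor_left_comm]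

/-- `ham14` is additive. -/
theorem ham14_xor (m m' : ℕ) : ham14 (m ^^^ m') = ham14 m ^^^ ham14 m' := hamAux_xor 9 m m'

set_option maxRecDepth 100000 in
set_option maxHeartbeats 2000000 in
/-- The tetrads have `4` points `< 14` and meet pairwise in `≤ 2` points (kernel check, `91 · 91` bit counts). -/
theorem blk14_facts : (∀ b < 91, popK 24 24 (blk14 b) = 4 ∧ blk14 b < 2 ^ 14) ∧
    ∀ b < 91, ∀ b' < 91, b = b' ∨ popK 24 24 (blk14 b &&& blk14 b') ≤ 2 := by
  constructor <;> decide +kernel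

set_option maxRecDepth 100000 in
/-- The code: words `< 2¹⁴`, minimum distance `4`, and the coset by `(1,1,0¹²)` has minimum weight `2`. -/
theorem ham14_facts : ∀ m < 512, ham14 m < 2 ^ 14 ∧ (m = 0 ∨ 4 ≤ popK 24 24 (ham14 m)) ∧
    2 ≤ popK 24 24 (ham14 m ^^^ 3) := by
  decide +kernel

/-! ### The layers -/

/-- The `14` cells of `ℝ¹⁴`. -/
def cells14 : Finset (Fin 24) := univ.filter fun j => j.val < 14

/-- `cells14 ⊆ cells`. -/
theorem cells14_sub : cells14 ⊆ cells := fun j hj => by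
  rw [cells14, mem_filter] at hj; exact mem_cells.mpr (by omega)

/-- `|cells14| = 14`. -/
theorem card_cells14 : cells14.card = 14 := by decide

/-- The sign vector of the word `c` on the `14` cells with `√2`-axis value `e`. -/
def lvec (c : ℕ) (e : ℤ) : Fin 24 → ℤ := pvec cells14 (fun j => c.testBit j.val) 1 e

/-- Two layer vectors: `ip = 14 − 2 · #{cells where the words differ} + 2 e e'`. -/
theorem ip_lvec (c c' : ℕ) (e e' : ℤ) : ip (lvec c e) (lvec c' e') =
    14 - 2 * ((cells14.filter fun j => (c ^^^ c').testBit j.val = true).card : ℤ) + 2 * e * e' := by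
  rw [lvec, lvec, ip_pvec_pvec cells14_sub cells14_sub, Finset.inter_self, card_cells14]
  have : (cells14.filter fun j : Fin 24 => (c.testBit j.val ^^ c'.testBit j.val) = true) =
      cells14.filter fun j => (c ^^^ c').testBit j.val = true := by
    congr 1; ext j; rw [Nat.testBit_xor]
  rw [this]; ring

/-- A word `< 2¹⁴` has all its ones among the `14` cells, so the count there is its weight. -/
theorem card_cells14_filter {w : ℕ} (hw : w < 2 ^ 14) :
    (cells14.filter fun j : Fin 24 => w.testBit j.val = true).card = popK 24 24 w := by
  rw [← wt_eq_popK, wt]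
  congr 1; ext j
  simp only [cells14, mem_filter, mem_univ, true_and, supp]
  constructor
  · exact fun h => h.2
  · exact fun h => ⟨val_lt_of_mem_supp_lt hw (by simpa [supp] using h), h⟩

/-- `m ⊕ m' < 512` for `m, m' < 512`. -/
theorem xor_lt_512 {m m' : ℕ} (hm : m < 512) (hm' : m' < 512) : m ^^^ m' < 512 := by
  have := Nat.xor_lt_two_pow (n := 9) (by simpa using hm) (by simpa using hm'); simpa using this

/-- Two distinct words of the code differ in `≥ 4` cells. -/
theorem four_le_card_diff {m m' : ℕ} (hm : m < 512) (hm' : m' < 512) (hne : m ≠ m') :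
    4 ≤ (cells14.filter fun j : Fin 24 => (ham14 m ^^^ ham14 m').testBit j.val = true).card := by
  obtain ⟨hlt, h4, -⟩ := ham14_facts (m ^^^ m') (xor_lt_512 hm hm')
  rw [← ham14_xor, card_cells14_filter hlt]
  rcases h4 with h0 | h4
  · exact absurd (eq_of_xor_eq_zero h0) hne
  · exact h4

/-- A word of the code and a word of the coset differ in `≥ 2` cells. -/
theorem two_le_card_diff {m m' : ℕ} (hm : m < 512) (hm' : m' < 512) :
    2 ≤ (cells14.filter fun j : Fin 24 => (ham14 m ^^^ (ham14 m' ^^^ 3)).testBit j.val = true).card := by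
  obtain ⟨hlt, -, h2⟩ := ham14_facts (m ^^^ m') (xor_lt_512 hm hm')
  have hlt3 : ham14 (m ^^^ m') ^^^ 3 < 2 ^ 14 := by
    have := Nat.xor_lt_two_pow (n := 14) hlt (by norm_num : 3 < 2 ^ 14); simpa using this
  rw [← Nat.xor_assoc, ← ham14_xor, card_cells14_filter hlt3]
  exact h2

/-! ### The four parts -/

/-- Central layer: `P₁₄ₐ` (Construction A on `S(3,4,14)`) at scale `2`, `1484` vectors. [cite: ConwaySloane1999, Ch. 5 §4.3] -/
def central : Finset (Fin 24 → ℤ) := (consA 14 91 blk14).image fun x => (2 : ℤ) • x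

/-- Lower layer: sign vectors of the code, axis `−1`, `512` vectors. -/
def layerM : Finset (Fin 24 → ℤ) := (range 512).image fun m => lvec (ham14 m) (-1)

/-- Upper layer: sign vectors of the coset by `(1,1,0¹²)`, axis `+1`, `512` vectors. -/
def layerP : Finset (Fin 24 → ℤ) := (range 512).image fun m => lvec (ham14 m ^^^ 3) 1

/-- Outer layers: `±2` on one pair `{2i, 2i+1}`, axis `±2`, `56` vectors. -/
def outer : Finset (Fin 24 → ℤ) :=
  ((univ : Finset (Fin 7)) ×ˢ (univ : Finset (Bool × Bool × Bool))).image fun q =>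
    pvec {⟨2 * q.1.val, by omega⟩, ⟨2 * q.1.val + 1, by omega⟩}
      (fun j => if j.val = 2 * q.1.val then q.2.1 else q.2.2.1) 2 (2 * sgn q.2.2.2)

/-- **The local arrangement `P₁₅ₐ`, integer model** (`2564` vectors of norm `16`). [cite: ConwaySloane1999, Ch. 5 §4.3] -/
def p15a : Finset (Fin 24 → ℤ) := central ∪ layerM ∪ layerP ∪ outer

attribute [irreducible] central layerM layerP outer p15a

/-- Facts of `P₁₄ₐ`. -/
theorem p14a_hyp : (14 ≤ 16) ∧ (∀ b < 91, popK 24 24 (blk14 b) = 4 ∧ blk14 b < 2 ^ 14) ∧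
    ∀ b < 91, ∀ b' < 91, b = b' ∨ popK 24 24 (blk14 b &&& blk14 b') ≤ 2 :=
  ⟨by norm_num, blk14_facts.1, blk14_facts.2⟩

/-- Members of the central layer are `2 •` a Construction-A vector: cells `< 14`, axis `0`, norm `16`, entries on
cells of absolute value `≤ 4` with sum `≤ 8`. -/
theorem central_props {x : Fin 24 → ℤ} (hx : x ∈ central) : ∃ y ∈ consA 14 91 blk14, x = (2 : ℤ) • y ∧
    ∃ S : Finset (Fin 24), ∃ f : Fin 24 → Bool, ∃ a : ℤ, (∀ j ∈ S, j.val < 14) ∧ y = pvec S f a 0 ∧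
      ((a = 1 ∧ S.card = 4) ∨ (a = 2 ∧ S.card = 1)) := by
  rw [central] at hx
  obtain ⟨y, hy, rfl⟩ := mem_image.mp hx
  refine ⟨y, hy, rfl, ?_⟩
  rw [consA, mem_union] at hy
  rcases hy with hy | hy
  · obtain ⟨b, hb, hyb⟩ := mem_biUnion.mp hy
    rw [mem_range] at hb
    obtain ⟨T, _, rfl⟩ := mem_blockVecs.mp hyb
    exact ⟨_, _, _, fun j hj => val_lt_of_mem_supp_lt (p14a_hyp.2.1 b hb).2 hj, rfl,
      Or.inl ⟨rfl, card_supp_blk p14a_hyp.2.1 hb⟩⟩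
  · obtain ⟨j, c, hj, rfl⟩ := mem_pointVecs.mp hy
    exact ⟨_, _, _, fun i hi => by rw [Finset.mem_singleton] at hi; subst hi; exact hj, rfl,
      Or.inr ⟨rfl, Finset.card_singleton j⟩⟩

/-! ### Cardinalities -/

/-- `|central| = 1484`. -/
theorem card_central : central.card = 1484 := by
  rw [central, card_image_of_injective _ (smul_right_injective _ (by norm_num : (2 : ℤ) ≠ 0)),
    card_consA p14a_hyp.1 p14a_hyp.2.1 p14a_hyp.2.2]

/-- Layer vectors determine the word on the cells. -/
theorem lvec_inj {c c' : ℕ} {e e' : ℤ} (h : lvec c e = lvec c' e') :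
    (cells14.filter fun j : Fin 24 => (c ^^^ c').testBit j.val = true).card = 0 := by
  obtain ⟨hf, -⟩ := pvec_eq_pvec cells14_sub (by norm_num : (1 : ℤ) ≠ 0) h
  rw [Finset.card_eq_zero, Finset.filter_eq_empty_iff]
  intro j hj
  rw [Nat.testBit_xor, hf j hj]; simp

/-- `|layerM| = 512`. -/
theorem card_layerM : layerM.card = 512 := by
  rw [layerM, card_image_of_injOn]
  · simp
  intro m hm m' hm' h
  simp only [coe_range, Set.mem_Iio] at hm hm'
  by_contra hne
  have := four_le_card_diff hm hm' hne
  rw [lvec_inj h] at this; omega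

/-- `|layerP| = 512`. -/
theorem card_layerP : layerP.card = 512 := by
  rw [layerP, card_image_of_injOn]
  · simp
  intro m hm m' hm' h
  simp only [coe_range, Set.mem_Iio] at hm hm'
  by_contra hne
  have h4 := four_le_card_diff hm hm' hne
  have h0 := lvec_inj h
  rw [show ham14 m ^^^ 3 ^^^ (ham14 m' ^^^ 3) = ham14 m ^^^ ham14 m' by
    rw [Nat.xor_assoc, Nat.xor_left_comm 3, Nat.xor_self, Nat.xor_zero]] at h0
  omega

/-- The outer vector with parameters `(i, a, b, t)`. -/
theorem outer_apply (i : Fin 7) (a b t : Bool) :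
    let x := pvec {(⟨2 * i.val, by omega⟩ : Fin 24), ⟨2 * i.val + 1, by omega⟩}
      (fun j : Fin 24 => if j.val = 2 * i.val then a else b) 2 (2 * sgn t)
    x ⟨2 * i.val, by omega⟩ = 2 * sgn a ∧ x ⟨2 * i.val + 1, by omega⟩ = 2 * sgn b ∧ x 16 = 2 * sgn t := by
  have hsub : ({(⟨2 * i.val, by omega⟩ : Fin 24), ⟨2 * i.val + 1, by omega⟩} : Finset (Fin 24)) ⊆ cells := by
    intro j hj
    rw [Finset.mem_insert, Finset.mem_singleton] at hj
    rcases hj with rfl | rfl <;> exact mem_cells.mpr (by simp; omega)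
  refine ⟨?_, ?_, pvec_apply_16 hsub _ _ _⟩
  · rw [pvec_apply_of_lt _ _ _ _ (by simp; omega), if_pos (by simp)]; simp
  · rw [pvec_apply_of_lt _ _ _ _ (by simp; omega), if_pos (by simp)]
    simp

/-- `|outer| = 56`. -/
theorem card_outer : outer.card = 56 := by
  rw [outer, card_image_of_injective]
  · simp
  rintro ⟨i, a, b, t⟩ ⟨i', a', b', t'⟩ h
  obtain ⟨h1, h2, h3⟩ := outer_apply i a b t
  obtain ⟨h1', h2', h3'⟩ := outer_apply i' a' b' t'
  simp only at h
  have hii : i = i' := by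
    by_contra hne
    have hv : (⟨2 * i.val, by omega⟩ : Fin 24).val < 16 := by simp; omega
    have e1 := congrFun h ⟨2 * i.val, by omega⟩
    rw [h1, pvec_apply_of_lt _ _ _ _ hv, if_neg] at e1
    · rcases sgn_cases a with h | h <;> rw [h] at e1 <;> norm_num at e1
    · rw [Finset.mem_insert, Finset.mem_singleton, Fin.ext_iff, Fin.ext_iff]
      simp only; omega
  subst hii
  rw [h] at h1 h2 h3
  rw [h1'] at h1; rw [h2'] at h2; rw [h3'] at h3
  have := sgn_injective (mul_left_cancel₀ (by norm_num : (2 : ℤ) ≠ 0) h1)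
  have := sgn_injective (mul_left_cancel₀ (by norm_num : (2 : ℤ) ≠ 0) h2)
  have := sgn_injective (mul_left_cancel₀ (by norm_num : (2 : ℤ) ≠ 0) h3)
  subst_vars; rfl

/-- The value at the `√2`-axis separates the parts: central `0`, lower `−1`, upper `+1`, outer `±2`. -/
theorem apply16_parts {x : Fin 24 → ℤ} :
    (x ∈ central → x 16 = 0) ∧ (x ∈ layerM → x 16 = -1) ∧ (x ∈ layerP → x 16 = 1) ∧
    (x ∈ outer → x 16 = 2 ∨ x 16 = -2) := by
  refine ⟨fun hx => ?_, fun hx => ?_, fun hx => ?_, fun hx => ?_⟩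
  · obtain ⟨y, -, rfl, S, f, a, hS, rfl, -⟩ := central_props hx
    have hSc : S ⊆ cells := fun j hj => mem_cells.mpr (by have := hS j hj; omega)
    rw [Pi.smul_apply, pvec_apply_16 hSc]; simp
  · rw [layerM] at hx; obtain ⟨m, _, rfl⟩ := mem_image.mp hx; exact pvec_apply_16 cells14_sub _ _ _
  · rw [layerP] at hx; obtain ⟨m, _, rfl⟩ := mem_image.mp hx; exact pvec_apply_16 cells14_sub _ _ _
  · rw [outer] at hx; obtain ⟨⟨i, a, b, t⟩, _, rfl⟩ := mem_image.mp hx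
    rw [(outer_apply i a b t).2.2]
    rcases sgn_cases t with h | h <;> rw [h] <;> simp

/-- **`|P₁₅ₐ| = 1484 + 512 + 512 + 56 = 2564`.** -/
theorem card_p15a : p15a.card = 2564 := by
  have d1 : Disjoint central layerM := Finset.disjoint_left.mpr fun x h1 h2 => by
    have := (apply16_parts.1 h1).symm.trans (apply16_parts.2.1 h2); omega
  have d2 : Disjoint (central ∪ layerM) layerP := by
    rw [disjoint_union_left]
    exact ⟨Finset.disjoint_left.mpr fun x h1 h2 => by
        have := (apply16_parts.1 h1).symm.trans (apply16_parts.2.2.1 h2); omega,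
      Finset.disjoint_left.mpr fun x h1 h2 => by
        have := (apply16_parts.2.1 h1).symm.trans (apply16_parts.2.2.1 h2); omega⟩
  have d3 : Disjoint (central ∪ layerM ∪ layerP) outer := by
    rw [disjoint_union_left, disjoint_union_left]
    refine ⟨⟨Finset.disjoint_left.mpr fun x h1 h2 => ?_, Finset.disjoint_left.mpr fun x h1 h2 => ?_⟩,
      Finset.disjoint_left.mpr fun x h1 h2 => ?_⟩
    · have e := apply16_parts.1 h1; rcases apply16_parts.2.2.2 h2 with h | h <;> omega
    · have e := apply16_parts.2.1 h1; rcases apply16_parts.2.2.2 h2 with h | h <;> omega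
    · have e := apply16_parts.2.2.1 h1; rcases apply16_parts.2.2.2 h2 with h | h <;> omega
  rw [p15a, card_union_of_disjoint d3, card_union_of_disjoint d2, card_union_of_disjoint d1, card_central,
    card_layerM, card_layerP, card_outer]

end Summit.Ventures.PackingBounds.Config.ConsA
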